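import Summits.AnomalousDissipation.AnomalousDissipation.Theorems.SolenoidalFractalHomogenisationLagrangianStepOneLevelDefs
import Summits.AnomalousDissipation.AnomalousDissipation.Theorems.SolenoidalFractalHomogenisationLagrangianStepOneLevelGlue
import HarnessLib

/-!
# K1L `LagrangianRenormalisationStep` (stmt-AnomalousDissipation-24912) — crux idea `fixed-shape-part-metric`
# (planner ad-ideate-p4 g4, lens «control» = controlling-quantity).  SKETCH: typed statements + the proved three-line lever.

The controlling quantity for the one-level shape map `Φ` of `stub_cellLawV` is Thompson's PART METRIC to the Perron–Frobenius
FIXED SHAPE `S⋆` (`Φ S⋆ ≡ S⋆`), in the TRANSVERSE LOEWNER ORDER `S ≼ S'` :⇔ `symb S ≤ symb S'` on transverse pairs: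
`V(S) = d_T(S, S⋆) = inf {log λ : S⋆/λ ≼ S ≼ λ S⋆}`.  For any map that is ORDER-REVERSING (OR) and (−1)-SUBHOMOGENEOUS (SH)
(`Φ(λS) ≽ λ⁻¹ Φ S`, `λ ≥ 1`) `V` is non-increasing (Krasnoselskiĭ–Thompson lemma, order-reversing form), hence EVERY order interval
`[[S⋆/λ, λ S⋆]]` is `Φ`-invariant and `renormStep`-invariant — with no aspect threshold and for the frozen model `excShape` too.
`interval_invariant`, `renormStep_interval`, `InInterval.nearIso` are PROVED below; the model-specific inputs (OR)/(SH)/fixed shape for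
`excShape` are typed as `Prop` targets (no axioms, no sorry).  Nothing here proves the crux, Onsager's conjecture or anomalous dissipation.
-/

set_option linter.dupNamespace false
set_option linter.unusedVariables false

namespace Summit.AnomalousDissipation.AnomalousDissipation.Cruxes.LagrangianRenormalisationStep.FixedShapePartMetric

open Literature.Analysis Literature.Analysis.FluidPDE Literature.Analysis.FunctionSpaces
open Summit.AnomalousDissipation.AnomalousDissipation.Theorems.SolenoidalFractalHomogenisation.LagrangianStep

noncomputable section

/-- Shapes = viscosity 4-tensors on `𝕋³`. -/
abbrev T4 : Type := Torus.Visc4 (Fin 3)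

/-! ## The transverse Loewner order and order intervals -/

/-- TRANSVERSE LOEWNER (pre)ORDER: `S ≼ S'` iff `σ_S(k,p) ≤ σ_{S'}(k,p)` for all transverse pairs `p ⊥ k`
(`Torus.NearIso S lo hi` is `lo•I ≼ S ≼ hi•I`).  A preorder; antisymmetric modulo symbol-zero tensors. -/
def TransLE (S S' : T4) : Prop :=
  ∀ k p : Fin 3 → ℝ, ∑ i, p i * k i = 0 → Torus.symb S k p ≤ Torus.symb S' k p

/-- The ORDER INTERVAL (closed part-metric ball of radius `log λ`) about `S⋆`: `S⋆/λ ≼ S ≼ λ S⋆`. -/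
def InInterval (Sstar : T4) (lam : ℝ) (S : T4) : Prop :=
  TransLE ((1 / lam) • Sstar) S ∧ TransLE S (lam • Sstar)

theorem TransLE.refl (S : T4) : TransLE S S := fun _ _ _ => le_rfl

theorem TransLE.trans {A B C : T4} (h₁ : TransLE A B) (h₂ : TransLE B C) : TransLE A C :=
  fun k p hkp => (h₁ k p hkp).trans (h₂ k p hkp)

theorem TransLE.smul {A B : T4} (h : TransLE A B) {c : ℝ} (hc : 0 ≤ c) : TransLE (c • A) (c • B) := by
  intro k p hkp
  rw [Torus.symb_smul, Torus.symb_smul]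
  exact mul_le_mul_of_nonneg_left (h k p hkp) hc

theorem TransLE.add {A B A' B' : T4} (h : TransLE A B) (h' : TransLE A' B') : TransLE (A + A') (B + B') := by
  intro k p hkp
  rw [Torus.symb_add, Torus.symb_add]
  exact add_le_add (h k p hkp) (h' k p hkp)

theorem smul_smul_cancel {lam : ℝ} (hlam : lam ≠ 0) (X : T4) : lam • ((1 / lam) • X) = X := by
  rw [smul_smul, mul_one_div_cancel hlam, one_smul]

theorem inv_smul_smul_cancel {lam : ℝ} (hlam : lam ≠ 0) (X : T4) : (1 / lam) • (lam • X) = X := by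
  rw [smul_smul, one_div_mul_cancel hlam, one_smul]

/-! ## The two order axioms of the lever and the fixed shape -/

/-- (OR) `Φ` is ORDER-REVERSING on the guard `W`. -/
def OrderReversingOn (Φ : T4 → T4) (W : T4 → Prop) : Prop :=
  ∀ S S' : T4, W S → W S' → TransLE S S' → TransLE (Φ S') (Φ S)

/-- (SH) `Φ` is (−1)-SUBHOMOGENEOUS on `W`: `λ⁻¹ Φ S ≼ Φ (λ S)` for `λ ≥ 1`
(equality = degree −1 homogeneity, the frozen model; strict for the rate-dependent response since the slot weight `ϑ` increases). -/
def SubhomogNegOneOn (Φ : T4 → T4) (W : T4 → Prop) : Prop :=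
  ∀ S : T4, ∀ lam : ℝ, 1 ≤ lam → W S → W (lam • S) → TransLE ((1 / lam) • Φ S) (Φ (lam • S))

/-- FIXED SHAPE (Perron–Frobenius eigen-shape of the unnormalised map, normalisation absorbed into `Φ`): `Φ S⋆ ≡ S⋆` in the preorder. -/
def IsFixedShape (Φ : T4 → T4) (Sstar : T4) : Prop :=
  TransLE (Φ Sstar) Sstar ∧ TransLE Sstar (Φ Sstar)

/-! ## THE LEVER (proved): (OR) + (SH) + fixed shape ⇒ every order interval about `S⋆` is `Φ`-invariant, any aspect -/

/-- **Krasnoselskiĭ–Thompson, order-reversing form.**  If `Φ` is order-reversing and (−1)-subhomogeneous on a guard containing the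
interval `[[S⋆/Λ', Λ' S⋆]]`-members used below, and `S⋆` is a fixed shape, then `S⋆/λ ≼ S ≼ λS⋆ ⇒ S⋆/λ ≼ Φ S ≼ λ S⋆` for every
`λ ≥ 1`: the part metric `d_T(·, S⋆)` is a Lyapunov function and each order interval is invariant — no threshold on `λ`. -/
theorem interval_invariant (Φ : T4 → T4) (W : T4 → Prop) (Sstar : T4)
    (hOR : OrderReversingOn Φ W) (hSH : SubhomogNegOneOn Φ W) (hfix : IsFixedShape Φ Sstar)
    {lam : ℝ} (hlam : 1 ≤ lam)
    (hW₁ : W ((1 / lam) • Sstar)) (hW₂ : W Sstar) (hW₃ : W (lam • Sstar))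
    {S : T4} (hWS : W S) (hS : InInterval Sstar lam S) :
    InInterval Sstar lam (Φ S) := by
  have hlam0 : (0:ℝ) < lam := lt_of_lt_of_le one_pos hlam
  have hlamne : lam ≠ 0 := ne_of_gt hlam0
  have hinv0 : (0:ℝ) ≤ 1 / lam := by positivity
  obtain ⟨hlo, hhi⟩ := hS
  constructor
  · -- lower: S ≼ λ S⋆ ⇒ Φ(λ S⋆) ≼ Φ S, and λ⁻¹ Φ S⋆ ≼ Φ(λ S⋆), and λ⁻¹ S⋆ ≼ λ⁻¹ Φ S⋆
    have h1 : TransLE (Φ (lam • Sstar)) (Φ S) := hOR S (lam • Sstar) hWS hW₃ hhi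
    have h2 : TransLE ((1 / lam) • Φ Sstar) (Φ (lam • Sstar)) := hSH Sstar lam hlam hW₂ hW₃
    have h3 : TransLE ((1 / lam) • Sstar) ((1 / lam) • Φ Sstar) := hfix.2.smul hinv0
    exact (h3.trans h2).trans h1
  · -- upper: λ⁻¹ S⋆ ≼ S ⇒ Φ S ≼ Φ(λ⁻¹ S⋆) ≼ λ Φ S⋆ ≼ λ S⋆
    have h1 : TransLE (Φ S) (Φ ((1 / lam) • Sstar)) := hOR ((1 / lam) • Sstar) S hW₁ hWS hlo
    have h2 : TransLE ((1 / lam) • Φ ((1 / lam) • Sstar)) (Φ (lam • ((1 / lam) • Sstar))) :=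
      hSH ((1 / lam) • Sstar) lam hlam hW₁ (by rw [smul_smul_cancel hlamne]; exact hW₂)
    have h2' : TransLE (Φ ((1 / lam) • Sstar)) (lam • Φ Sstar) := by
      have h := h2.smul (le_of_lt hlam0)
      rw [smul_smul_cancel hlamne, smul_smul_cancel hlamne] at h
      exact h
    have h3 : TransLE (lam • Φ Sstar) (lam • Sstar) := hfix.1.smul (le_of_lt hlam0)
    exact (h1.trans h2').trans h3

/-- One `renormStep` (convex combination of `S` and `Φ S`, `g ≥ 0`) keeps every order interval. -/
theorem renormStep_interval (Φ : T4 → T4) (Sstar : T4) {lam g : ℝ} (hg : 0 ≤ g) {S : T4}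
    (hS : InInterval Sstar lam S) (hΦS : InInterval Sstar lam (Φ S)) :
    InInterval Sstar lam (renormStep Φ g S) := by
  have hg1 : (0:ℝ) ≤ 1 / (1 + g) := by positivity
  have hne : (1 + g) ≠ 0 := by positivity
  have key : ∀ X : T4, (1 / (1 + g)) • (X + g • X) = X := fun X => by
    rw [show X + g • X = (1 + g) • X by rw [add_smul, one_smul], smul_smul, one_div_mul_cancel hne, one_smul]
  constructor
  · have h := ((hS.1.add (hΦS.1.smul hg)).smul hg1)
    rw [key] at h
    exact h
  · have h := ((hS.2.add (hΦS.2.smul hg)).smul hg1)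
    rw [key] at h
    exact h

/-- The interval about `S⋆` feeds the downstream stubs UNCHANGED: `S ∈ [[S⋆/λ, λS⋆]]` and `NearIso S⋆ lo hi` give
`NearIso S (lo/λ) (hi λ)` — exactly the window hypothesis `∃ lam ∈ [1,Λ], NearIso 𝔸 (ν lo/lam) (ν hi lam)` of (V), (T), (L). -/
theorem InInterval.nearIso {Sstar S : T4} {lam lo hi : ℝ} (hlam : 1 ≤ lam)
    (hstar : Torus.NearIso Sstar lo hi) (hS : InInterval Sstar lam S) :
    Torus.NearIso S (lo / lam) (hi * lam) := by
  have hlam0 : (0:ℝ) < lam := lt_of_lt_of_le one_pos hlam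
  intro k p hkp
  obtain ⟨hl, hh⟩ := hstar k p hkp
  have h1 := hS.1 k p hkp
  have h2 := hS.2 k p hkp
  rw [Torus.symb_smul] at h1 h2
  have hQ : 0 ≤ (∑ a, k a ^ 2) * (∑ i, p i ^ 2) := by positivity
  constructor
  · calc lo / lam * ((∑ a, k a ^ 2) * (∑ i, p i ^ 2)) = (1 / lam) * (lo * ((∑ a, k a ^ 2) * (∑ i, p i ^ 2))) := by ring
      _ ≤ (1 / lam) * Torus.symb Sstar k p := mul_le_mul_of_nonneg_left hl (by positivity)
      _ ≤ Torus.symb S k p := h1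
  · calc Torus.symb S k p ≤ lam * Torus.symb Sstar k p := h2
      _ ≤ lam * (hi * ((∑ a, k a ^ 2) * (∑ i, p i ^ 2))) := mul_le_mul_of_nonneg_left hh (le_of_lt hlam0)
      _ = hi * lam * ((∑ a, k a ^ 2) * (∑ i, p i ^ 2)) := by ring

/-! ## Transfer `C⁺`: the window clause RE-CENTRED at the fixed shape (proposed re-cut of `WindowClause` in `stub_cellLawV`) -/

/-- `WindowClause⋆`: the nested ORDER INTERVALS about a fixed shape `S⋆` (with `NearIso S⋆ lo hi`), guarded by `OddSmall β`, are
`Φ`-invariant for `λ ∈ [λ₀, Λ]` (`λ₀ ≥ 1` so that the isotropic start `isoVisc 1 ∈ [[S⋆/λ₀, λ₀ S⋆]]`).  By `InInterval.nearIso`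
every member satisfies the typed hypothesis `∃ lam ∈ [1,Λ], NearIso (lo/lam) (hi lam)` of `SlowVectorClause` / `CellEnergyClauses` /
`stub_oneLevelL`, so only `stub_cellLawV`'s conclusion and `renormStep_window`/`shapeSeq_window` change (to `renormStep_interval`). -/
def IntervalWindowClause (Φ : T4 → T4) (Sstar : T4) (lo hi lam₀ Λ β : ℝ) : Prop :=
  Torus.NearIso Sstar lo hi ∧ 1 ≤ lam₀ ∧ InInterval Sstar lam₀ (Torus.isoVisc 1) ∧
  ∀ lam ∈ Set.Icc lam₀ Λ, ∀ S : T4, Torus.OddSmall S β → InInterval Sstar lam S →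
    Torus.OddSmall (Φ S) β ∧ InInterval Sstar lam (Φ S)

/-- One `renormStep` keeps the guarded interval window: odd part by convexity exactly as in the landed `renormStep_window`,
interval by `renormStep_interval` — the drop-in replacement for `renormStep_window` under the re-centred clause. -/
theorem renormStep_intervalWindow {Φ : T4 → T4} {Sstar : T4} {lo hi lam₀ Λ β : ℝ}
    (hβ : 0 ≤ β) (hwin : IntervalWindowClause Φ Sstar lo hi lam₀ Λ β) (hΛ : lam₀ ≤ Λ) {g : ℝ} (hg : 0 ≤ g)
    {S : T4} (hSo : Torus.OddSmall S β) (hSi : InInterval Sstar lam₀ S) :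
    Torus.OddSmall (renormStep Φ g S) β ∧ InInterval Sstar lam₀ (renormStep Φ g S) := by
  obtain ⟨_, _, _, hstep⟩ := hwin
  obtain ⟨hΦo, hΦi⟩ := hstep lam₀ ⟨le_rfl, hΛ⟩ S hSo hSi
  refine ⟨?_, renormStep_interval Φ Sstar hg hSi hΦi⟩
  have h := (hSo.add (hΦo.smul g) hβ (mul_nonneg hg hβ)).smul (1 / (1 + g))
  have hne : (1 + g) ≠ 0 := by positivity
  exact oddSmall_congr h (by field_simp)

/-- Every shape of the chain `shapeSeq Φ g j` stays in the guarded interval `[[S⋆/λ₀, λ₀ S⋆]]` — the drop-in replacement for the landed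
`shapeSeq_window` (same induction; start `isoVisc 1 ∈ [[S⋆/λ₀, λ₀S⋆]]` is a clause of `IntervalWindowClause`). -/
theorem shapeSeq_intervalWindow {Φ : T4 → T4} {Sstar : T4} {lo hi lam₀ Λ β : ℝ}
    (hβ : 0 ≤ β) (hwin : IntervalWindowClause Φ Sstar lo hi lam₀ Λ β) (hΛ : lam₀ ≤ Λ)
    {g : ℕ → ℝ} (hg : ∀ i, 0 ≤ g i) (j : ℕ) :
    ∀ d, Torus.OddSmall (shapeSeq Φ g j d) β ∧ InInterval Sstar lam₀ (shapeSeq Φ g j d)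
  | 0 => ⟨Torus.oddSmall_isoVisc 1 β, hwin.2.2.1⟩
  | d + 1 => by
      obtain ⟨ho, hi'⟩ := shapeSeq_intervalWindow hβ hwin hΛ hg j d
      exact renormStep_intervalWindow hβ hwin hΛ (hg (j - d)) ho hi'

/-- … hence every chain shape lies in the `NearIso` band `(lo/λ₀, hi·λ₀)` — verbatim the window hypothesis consumed by (V), (T), (L). -/
theorem shapeSeq_nearIso {Φ : T4 → T4} {Sstar : T4} {lo hi lam₀ Λ β : ℝ}
    (hβ : 0 ≤ β) (hwin : IntervalWindowClause Φ Sstar lo hi lam₀ Λ β) (hΛ : lam₀ ≤ Λ)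
    {g : ℕ → ℝ} (hg : ∀ i, 0 ≤ g i) (j d : ℕ) :
    Torus.NearIso (shapeSeq Φ g j d) (lo / lam₀) (hi * lam₀) :=
  InInterval.nearIso hwin.2.1 hwin.1 (shapeSeq_intervalWindow hβ hwin hΛ hg j d).2

/-! ## Model-specific inputs, typed as targets (the idea's stubs-to-be; none is asserted) -/

/-- Guard: symmetric transverse blocks (`OddSmall 0`) and uniform transverse coercivity. -/
def Guard (lo : ℝ) (S : T4) : Prop := Torus.OddSmall S 0 ∧ ∃ hi, Torus.NearIso S lo hi

/-- (OR-frozen) TARGET: the frozen large-gain map `excShape W M` is order-reversing on coercive symmetric shapes — operator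
antitonicity of `B ↦ B⁻¹` on each transverse `2×2` block `P_m Σ_S(m̂) P_m` plus positivity of the slot weights; ANY word `W`. -/
def ExcShapeOrderReversing {k : ℕ} (W : LatticeShear.LatticeWord k) (M lo : ℝ) : Prop :=
  OrderReversingOn (excShape W M) (Guard lo)

/-- (SH-frozen) TARGET: `excShape` is homogeneous of degree −1 on coercive shapes (each block inverse is), hence (SH) with equality. -/
def ExcShapeHomogNegOne {k : ℕ} (W : LatticeShear.LatticeWord k) (M lo : ℝ) : Prop :=
  ∀ S : T4, Guard lo S → ∀ lam : ℝ, 0 < lam → ∀ i a j b, excShape W M (lam • S) i a j b = (1 / lam) * excShape W M S i a j b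

/-- (FIX) TARGET: a Perron–Frobenius eigen-shape of the frozen map IN THE OPEN CONE: `excShape W M S⋆ ≡ N • S⋆`, `S⋆` coercive symmetric
(cubature word: aspect `hi⋆/lo⋆ − 1 = 6.98e-7/M²`, kit j303631 PART A).  A CONDITION ON THE WORD is needed — stated under the crux's own hypothesis
`IsotropicWordGain W c₀`: kit j304121 finds interior eigen-shapes for 12/12 direction-complete random reweightings but NONE (eigen-shape on the
cone boundary) for 4/12 direction-poor sub-words, so the unconditioned statement is false for some sparse `W`.  Nonlinear Perron–Frobenius step. -/
def ExcShapeFixedShape {k : ℕ} (W : LatticeShear.LatticeWord k) (M c₀ : ℝ) : Prop :=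
  0 < c₀ → LatticeShear.IsotropicWordGain W c₀ → 0 < M →
    ∃ Sstar : T4, ∃ N > (0:ℝ), ∃ lo > (0:ℝ), Guard lo Sstar ∧ IsFixedShape (fun S => (1 / N) • excShape W M S) Sstar

/-- (ANG) TARGET (strictness, numerical so far): STRICT contraction of Hilbert's projective (angular) part about `S⋆` —
`osc log(σ_{ΦS}/σ_{S⋆}) ≤ κ · osc log(σ_S/σ_{S⋆})` with `κ < 1` on `[[S⋆/Λ, ΛS⋆]]` (sampled `κ ≤ 0.56` up to aspect 20, local `≥ 0.65`;
p5's anisotropic spectral radius 0.634 is its linearisation).  Stated through the two Perron numbers `M(S/S⋆)`, `M(S⋆/S)`. -/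
def AngularContraction (Φ : T4 → T4) (Sstar : T4) (Λ κ : ℝ) : Prop :=
  ∀ S : T4, ∀ a b : ℝ, 0 < a → a ≤ b → b / a ≤ Λ ^ 2 → TransLE (a • Sstar) S → TransLE S (b • Sstar) →
    ∃ a' b' : ℝ, 0 < a' ∧ a' ≤ b' ∧ TransLE (a' • Sstar) (Φ S) ∧ TransLE (Φ S) (b' • Sstar) ∧
      Real.log (b' / a') ≤ κ * Real.log (b / a)

end

end Summit.AnomalousDissipation.AnomalousDissipation.Cruxes.LagrangianRenormalisationStep.FixedShapePartMetric
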